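import Literature.RepresentationTheory.KonnoKonno2007.JunctionVacuumTwist
import Literature.Analysis.SegalBargmann.SchwartzTensorSchurTransport
import HarnessLib

/-!
# Factorisation of an archimedean Weil datum along a block-diagonal subgroup: `ω(s u)(Φ₁ ⊠ Φ₂) = χ(u) • (ω₁(u) Φ₁) ⊠ Φ₂`

Topic `NumberTheory/Weil1964`; namespace `Literature.NumberTheory.Weil1964`.  Origin: `pub-hodgecm` MODEL-CONSTRUCTION
sub-cell, theta lane (seat mc-theta-3 gen 5), item (T-j) «the archimedean factorisation of ω_∞ at the harmonic
vectors» (model1-g5 RULING (T-j), 2026-08-19).  KERNEL MATHEMATICS ONLY: everything below is proved; no record, no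
cited hypothesis.

Setting (Folland carriers `SR σ = 𝓢(ℝ^σ, ℂ)`, Heisenberg operators `rhoS p q`, the separate-variables product
`Φ₁ ⊠ Φ₂ = tensorPi Φ₁ Φ₂ ∈ 𝓢(ℝ^{σ₁ ⊕ σ₂})` of `Analysis/SegalBargmann`).  A BIG family `ω : G → End 𝓢(ℝ^{σ₁ ⊕ σ₂})`,
Heisenberg-covariant over phase-space maps `ι g` (`IsPhaseCovariantS`), a SMALL family `ω₁ : G₁ → End 𝓢(ℝ^{σ₁})`
covariant over `ι₁ u`, and a homomorphism `s : G₁ →* G` along which the big phase maps are BLOCK-DIAGONAL with the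
identity in the second block: `ι (s u) = blockPhase (ι₁ u) id`.  (Model case: `G = U(V)(L⁺ ⊗ ℝ) = ∏_w U(V_w)` for a
hermitian space over a CM field with `g = [L⁺ : ℚ]` real places, `G₁ = U(2,1) = U(V_{w₁})`, `s` the inclusion of the
`w₁`-factor, `σ₁` the `w₁`-coordinates and `σ₂` the coordinates at the definite places `w₂, …, w_g`.)

* §1 `repCLE` — the operators of a representation with continuous operators, as continuous linear automorphisms.
* §2 **`exists_ne_zero_smul_tensorPi_of_block`** — for each `u` there is ONE scalar `c ≠ 0` with
  `ω (s u) (Φ₁ ⊠ Φ₂) = c • (ω₁ u Φ₁) ⊠ Φ₂` for all `Φ₁, Φ₂`: the two-factor Schur lemma of the tree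
  (`SegalBargmann.exists_ne_zero_smul_of_tensor_covariant_equiv`, Folland 1989 Prop. (1.43)) applied to
  `M = ω (s u)`, `A₁ = ω₁ u`, `A₂ = 1`.
* §3 **the factor character** `factorChar`: the scalar is unique, multiplicative (`factorChar_mul`, `factorChar_one`,
  `factorCharHom : G₁ →* ℂˣ`).
* §4 **the twisted small family** `charTwist χ ω₁`, `u ↦ χ u • ω₁ u` (the tree's
  `Weil1964.charTwist` of `KonnoKonno2007/JunctionVacuumTwist`), is again Heisenberg-covariant over `ι₁` and
  factorises the big one EXACTLY: `ω (s u) (Φ₁ ⊠ Φ₂) = (charTwist … u Φ₁) ⊠ Φ₂` — so a consumer holding analytic facts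
  for ANY covariant small family (the junction theorems of `RepresentationTheory/KonnoKonno2007`) applies them to the
  twisted family and never meets the character.
* §5 **archimedean Weil data** (`IsArchWeilDatum`): the circle-valued factor character `factorCharCircle` (under the
  unitary lifts (w2′)), `IsArchWeilDatum.isBlockPair`, and — with the tree's `IsArchWeilDatum.twist` — the headline
  **`IsArchWeilDatum.exists_twist_factorisation`**: `∃ ω₁'` an archimedean Weil datum over the same `ι𝕎₁`, with
  continuous operators, and `ω (s u) (Φ₁ ⊠ Φ₂) = (ω₁' u Φ₁) ⊠ Φ₂` for all `u, Φ₁, Φ₂` (`|χ| = 1` from the unitary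
  lifts via `‖f ⊠ g‖_{L²} = ‖f‖ ‖g‖`, continuity of `χ` from orbit continuity via point evaluations).

Why a character at all: two honest Weil-type representations of a unitary group over the same symplectic data differ
by a unitary character (`IsArchWeilDatum.exists_continuous_character`; for unitary dual pairs the splitting depends on
a character choice, Kudla 1994 / Harris–Kudla–Sweet 1996), so `c` is not `1` in general; the twist absorbs it.

## References

* G. B. Folland, *Harmonic Analysis in Phase Space*, Princeton UP (1989), Prop. (1.43), §1.7, §4.2 (4.23).
* A. Weil, *Sur certains groupes d'opérateurs unitaires*, Acta Math. 111 (1964), n° 37–38 (restriction of `𝐫` to a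
  direct-sum decomposition).
* S. Kudla, *Splitting metaplectic covers of dual reductive pairs*, Israel J. Math. 87 (1994) 361–401, §1 (the
  character dependence of the splitting).
-/

set_option autoImplicit false

noncomputable section

open MeasureTheory Complex SchwartzMap

namespace Literature.NumberTheory.Weil1964

open Literature.Analysis.SegalBargmann Literature.RepresentationTheory.HeisenbergGroup

local notation "L2R" σ => Lp ℂ 2 (volume : Measure (σ → ℝ))
local notation "SR" σ => SchwartzMap (σ → ℝ) ℂ
local notation "PV" σ => (σ → ℝ) × (σ → ℝ)
local notation "SpR" σ => symplecticGroup (polar (dotPairing σ))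

/-! ## §1 Representations with continuous operators -/

section RepCLE

variable {G : Type*} [Group G] {S : Type*} [AddCommGroup S] [Module ℂ S] [TopologicalSpace S]

omit [TopologicalSpace S] in
/-- `ω g (ω g⁻¹ x) = x`. [folklore] -/
theorem rep_apply_inv_apply (ω : Representation ℂ G S) (g : G) (x : S) : ω g (ω g⁻¹ x) = x := by
  rw [← Module.End.mul_apply, ← map_mul, mul_inv_cancel, map_one, Module.End.one_apply]

omit [TopologicalSpace S] in
/-- `ω g⁻¹ (ω g x) = x`. [folklore] -/
theorem rep_inv_apply_apply (ω : Representation ℂ G S) (g : G) (x : S) : ω g⁻¹ (ω g x) = x := by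
  rw [← Module.End.mul_apply, ← map_mul, inv_mul_cancel, map_one, Module.End.one_apply]

/-- **The operators of a representation with continuous operators, as continuous linear automorphisms**
(inverse `ω g⁻¹`). [folklore] -/
def repCLE (ω : Representation ℂ G S) (hc : ∀ g, Continuous (ω g)) (g : G) : S ≃L[ℂ] S where
  toLinearEquiv := LinearEquiv.ofLinear (ω g) (ω g⁻¹) (LinearMap.ext (rep_apply_inv_apply ω g))
    (LinearMap.ext (rep_inv_apply_apply ω g))
  continuous_toFun := hc g
  continuous_invFun := hc g⁻¹

/-- `repCLE ω hc g` acts as `ω g`. [folklore] -/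
@[simp] theorem repCLE_apply (ω : Representation ℂ G S) (hc : ∀ g, Continuous (ω g)) (g : G) (x : S) :
    repCLE ω hc g x = ω g x := rfl

/-- the underlying continuous linear map of `repCLE ω hc g` acts as `ω g`. [folklore] -/
theorem coe_repCLE_apply (ω : Representation ℂ G S) (hc : ∀ g, Continuous (ω g)) (g : G) (x : S) :
    (repCLE ω hc g : S →L[ℂ] S) x = ω g x := rfl

end RepCLE

/-! ## §2 The factorisation up to a scalar -/

section Factor

variable {σ₁ σ₂ : Type*} [Fintype σ₁] [Fintype σ₂] [DecidableEq σ₁] [DecidableEq σ₂]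
variable {G₁ G : Type*} [Group G₁] [Group G]
variable {ι : G → PhaseMap (σ₁ ⊕ σ₂)} {ω : Representation ℂ G (SR (σ₁ ⊕ σ₂))}
  {ι₁ : G₁ → PhaseMap σ₁} {ω₁ : Representation ℂ G₁ (SR σ₁)} {s : G₁ →* G}

omit [Fintype σ₁] [DecidableEq σ₁] [DecidableEq σ₂] in
/-- the identity of `𝓢(ℝ^{σ₂})` is Heisenberg-covariant over the identity phase map (the second block). [folklore] -/
theorem refl_rhoS (p q : σ₂ → ℝ) (g : SR σ₂) :
    ContinuousLinearEquiv.refl ℂ (SR σ₂) (rhoS p q g) =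
      rhoS ((id : PhaseMap σ₂) (p, q)).1 ((id : PhaseMap σ₂) (p, q)).2 (ContinuousLinearEquiv.refl ℂ (SR σ₂) g) :=
  rfl

/-- **FACTORISATION OF A BLOCK-DIAGONALLY COVARIANT FAMILY ON PRODUCT VECTORS, up to one nonzero scalar.**  If the
big family `ω` is Heisenberg-covariant over `ι`, the small family `ω₁` over `ι₁`, all operators are continuous, and
along `s : G₁ →* G` the big phase maps are `blockPhase (ι₁ u) id`, then for every `u` there is `c ≠ 0` with
`ω (s u) (Φ₁ ⊠ Φ₂) = c • (ω₁ u Φ₁) ⊠ Φ₂` for all `Φ₁ ∈ 𝓢(ℝ^{σ₁})`, `Φ₂ ∈ 𝓢(ℝ^{σ₂})`.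
[cite: Folland1989, Prop. (1.43)] -/
theorem exists_ne_zero_smul_tensorPi_of_block (hω : IsPhaseCovariantS ι (fun g => ω g))
    (hc : ∀ g, Continuous (ω g)) (hω₁ : IsPhaseCovariantS ι₁ (fun u => ω₁ u)) (hc₁ : ∀ u, Continuous (ω₁ u))
    (hs : ∀ u, ι (s u) = blockPhase (ι₁ u) id) (u : G₁) :
    ∃ c : ℂ, c ≠ 0 ∧ ∀ (Φ₁ : SR σ₁) (Φ₂ : SR σ₂), ω (s u) (tensorPi Φ₁ Φ₂) = c • tensorPi (ω₁ u Φ₁) Φ₂ := by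
  have hM : ∀ (P Q : σ₁ ⊕ σ₂ → ℝ) (F : SR (σ₁ ⊕ σ₂)), repCLE ω hc (s u) (rhoS P Q F) =
      rhoS (blockPhase (ι₁ u) id (P, Q)).1 (blockPhase (ι₁ u) id (P, Q)).2 (repCLE ω hc (s u) F) := by
    intro P Q F
    rw [repCLE_apply, repCLE_apply, ← hs u]
    exact hω (s u) P Q F
  have hA₁ : ∀ (p q : σ₁ → ℝ) (f : SR σ₁), repCLE ω₁ hc₁ u (rhoS p q f) =
      rhoS ((ι₁ u) (p, q)).1 ((ι₁ u) (p, q)).2 (repCLE ω₁ hc₁ u f) := fun p q f => by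
    rw [repCLE_apply, repCLE_apply]; exact hω₁ u p q f
  obtain ⟨c, hc0, -, hcfg⟩ := exists_ne_zero_smul_of_tensor_covariant_equiv (repCLE ω hc (s u)) hM
    (repCLE ω₁ hc₁ u) (ContinuousLinearEquiv.refl ℂ (SR σ₂)) hA₁ refl_rhoS
    (tensorOp (repCLE ω₁ hc₁ u : (SR σ₁) →L[ℂ] SR σ₁)
      (ContinuousLinearEquiv.refl ℂ (SR σ₂) : (SR σ₂) →L[ℂ] SR σ₂))
    (fun f g => tensorOp_tensorPi _ _ f g)
  exact ⟨c, hc0, fun Φ₁ Φ₂ => hcfg Φ₁ Φ₂⟩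

end Factor

/-! ## §3 The factor character -/

section Character

variable {σ₁ σ₂ : Type*} [Fintype σ₁] [Fintype σ₂] [DecidableEq σ₁] [DecidableEq σ₂]
variable {G₁ G : Type*} [Group G₁] [Group G]

/-- **HYPOTHESIS BUNDLE: a block-diagonally covariant pair.**  A big family `ω` on `𝓢(ℝ^{σ₁ ⊕ σ₂})`
Heisenberg-covariant over `ι`, a small family `ω₁` on `𝓢(ℝ^{σ₁})` covariant over `ι₁`, continuous operators, and
`s : G₁ →* G` along which `ι (s u) = blockPhase (ι₁ u) id`.  (Every field is a property to be PROVED of concrete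
data — for an archimedean Weil datum read off a global metaplectic representation the covariances are (w2) of
`IsArchWeilDatum`, operator continuity comes from tensor stripping, and the block identity is the statement that the
`w₁`-factor of `U(V)(L⁺ ⊗ ℝ)` moves only the `w₁`-coordinates.) [folklore] -/
structure IsBlockPair (ι : G → PhaseMap (σ₁ ⊕ σ₂)) (ω : Representation ℂ G (SR (σ₁ ⊕ σ₂)))
    (ι₁ : G₁ → PhaseMap σ₁) (ω₁ : Representation ℂ G₁ (SR σ₁)) (s : G₁ →* G) : Prop where
  /-- Heisenberg covariance of the big family. -/
  covariant : IsPhaseCovariantS ι (fun g => ω g)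
  /-- the big operators are continuous on `𝓢`. -/
  continuous_op : ∀ g, Continuous (ω g)
  /-- Heisenberg covariance of the small family. -/
  covariant₁ : IsPhaseCovariantS ι₁ (fun u => ω₁ u)
  /-- the small operators are continuous on `𝓢`. -/
  continuous_op₁ : ∀ u, Continuous (ω₁ u)
  /-- along `s` the big phase maps are block-diagonal with identity second block. -/
  block : ∀ u, ι (s u) = blockPhase (ι₁ u) id

namespace IsBlockPair

variable {ι : G → PhaseMap (σ₁ ⊕ σ₂)} {ω : Representation ℂ G (SR (σ₁ ⊕ σ₂))}
  {ι₁ : G₁ → PhaseMap σ₁} {ω₁ : Representation ℂ G₁ (SR σ₁)} {s : G₁ →* G}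

/-- (F) for a block pair. [cite: Folland1989, Prop. (1.43)] -/
theorem exists_ne_zero_smul (h : IsBlockPair ι ω ι₁ ω₁ s) (u : G₁) :
    ∃ c : ℂ, c ≠ 0 ∧ ∀ (Φ₁ : SR σ₁) (Φ₂ : SR σ₂), ω (s u) (tensorPi Φ₁ Φ₂) = c • tensorPi (ω₁ u Φ₁) Φ₂ :=
  exists_ne_zero_smul_tensorPi_of_block h.covariant h.continuous_op h.covariant₁ h.continuous_op₁ h.block u

/-- **The factor character** `χ(u)`: the scalar in `ω (s u) (Φ₁ ⊠ Φ₂) = χ(u) • (ω₁ u Φ₁) ⊠ Φ₂`. [folklore] -/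
def factorChar (h : IsBlockPair ι ω ι₁ ω₁ s) (u : G₁) : ℂ := (h.exists_ne_zero_smul u).choose

/-- `χ(u) ≠ 0`. [folklore] -/
theorem factorChar_ne_zero (h : IsBlockPair ι ω ι₁ ω₁ s) (u : G₁) : h.factorChar u ≠ 0 :=
  (h.exists_ne_zero_smul u).choose_spec.1

/-- **`ω (s u) (Φ₁ ⊠ Φ₂) = χ(u) • (ω₁ u Φ₁) ⊠ Φ₂`.** [cite: Folland1989, Prop. (1.43)] -/
theorem apply_tensorPi (h : IsBlockPair ι ω ι₁ ω₁ s) (u : G₁) (Φ₁ : SR σ₁) (Φ₂ : SR σ₂) :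
    ω (s u) (tensorPi Φ₁ Φ₂) = h.factorChar u • tensorPi (ω₁ u Φ₁) Φ₂ :=
  (h.exists_ne_zero_smul u).choose_spec.2 Φ₁ Φ₂

omit [DecidableEq σ₁] [DecidableEq σ₂] in
/-- the small operators are injective. [folklore] -/
theorem injective₁ (h : IsBlockPair ι ω ι₁ ω₁ s) (u : G₁) : Function.Injective (ω₁ u) :=
  (repCLE ω₁ h.continuous_op₁ u).injective

/-- **Uniqueness of the scalar**: tested on ONE product of nonzero vectors. [folklore] -/
theorem eq_factorChar (h : IsBlockPair ι ω ι₁ ω₁ s) {u : G₁} {c : ℂ} {Φ₁ : SR σ₁} {Φ₂ : SR σ₂} (hΦ₁ : Φ₁ ≠ 0)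
    (hΦ₂ : Φ₂ ≠ 0) (hc : ω (s u) (tensorPi Φ₁ Φ₂) = c • tensorPi (ω₁ u Φ₁) Φ₂) : c = h.factorChar u := by
  have hT : tensorPi (ω₁ u Φ₁) Φ₂ ≠ 0 :=
    tensorPi_ne_zero (fun h0 => hΦ₁ (h.injective₁ u (h0.trans (map_zero _).symm))) hΦ₂
  exact smul_left_injective ℂ hT (hc.symm.trans (h.apply_tensorPi u Φ₁ Φ₂))

/-- **`χ(u v) = χ(u) χ(v)`** (`ω` and `ω₁` are homomorphisms). [folklore] -/
theorem factorChar_mul (h : IsBlockPair ι ω ι₁ ω₁ s) (u v : G₁) :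
    h.factorChar (u * v) = h.factorChar u * h.factorChar v := by
  symm
  refine h.eq_factorChar (hermitePi_ne_zero 0) (hermitePi_ne_zero 0) ?_
  rw [map_mul s, map_mul ω, map_mul ω₁, Module.End.mul_apply, Module.End.mul_apply, h.apply_tensorPi v,
    map_smul, h.apply_tensorPi u, smul_smul, mul_comm]

/-- **`χ(1) = 1`.** [folklore] -/
theorem factorChar_one (h : IsBlockPair ι ω ι₁ ω₁ s) : h.factorChar 1 = 1 := by
  symm
  refine h.eq_factorChar (hermitePi_ne_zero (0 : σ₁ →₀ ℕ)) (hermitePi_ne_zero (0 : σ₂ →₀ ℕ)) ?_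
  rw [map_one s, map_one ω, map_one ω₁, Module.End.one_apply, Module.End.one_apply, one_smul]

/-- **The factor character as a homomorphism `G₁ →* ℂ`.** [folklore] -/
def factorCharHom (h : IsBlockPair ι ω ι₁ ω₁ s) : G₁ →* ℂ where
  toFun := h.factorChar
  map_one' := h.factorChar_one
  map_mul' := h.factorChar_mul

/-- Unfolding. [folklore] -/
@[simp] theorem factorCharHom_apply (h : IsBlockPair ι ω ι₁ ω₁ s) (u : G₁) : h.factorCharHom u = h.factorChar u := rfl

end IsBlockPair

/-! ### §3b Unitarity of the factor character under unitary lifts -/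

omit [DecidableEq σ₁] in
/-- `‖toL2 F‖ = (∫ ‖F‖²)^{1/2}`. [folklore] -/
theorem norm_toL2_eq (F : SR σ₁) : ‖toL2 F‖ = (∫ x, ‖F x‖ ^ 2) ^ (2 : ℝ)⁻¹ := by
  rw [toL2_apply, SchwartzMap.norm_toLp' two_ne_zero ENNReal.ofNat_ne_top]
  simp only [ENNReal.toReal_ofNat, Real.rpow_two]

omit [DecidableEq σ₁] [DecidableEq σ₂] in
/-- **`∫ ‖f ⊠ g‖² = (∫ ‖f‖²)(∫ ‖g‖²)`** (Fubini). [folklore] -/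
theorem integral_norm_sq_tensorPi (f : SR σ₁) (g : SR σ₂) :
    ∫ x, ‖tensorPi f g x‖ ^ 2 = (∫ y, ‖f y‖ ^ 2) * ∫ z, ‖g z‖ ^ 2 := by
  have h := integral_mul_comp_inl_inr (fun y : σ₁ → ℝ => ((‖f y‖ ^ 2 : ℝ) : ℂ))
    (fun z : σ₂ → ℝ => ((‖g z‖ ^ 2 : ℝ) : ℂ))
  simp only [← Complex.ofReal_mul] at h
  have h' : ∫ x : σ₁ ⊕ σ₂ → ℝ, ‖tensorPi f g x‖ ^ 2 =
      ∫ x : σ₁ ⊕ σ₂ → ℝ, ‖f (x ∘ Sum.inl)‖ ^ 2 * ‖g (x ∘ Sum.inr)‖ ^ 2 := by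
    refine integral_congr_ae (Filter.Eventually.of_forall fun x => ?_)
    simp only [tensorPi_apply, norm_mul, mul_pow]
  rw [h']
  exact_mod_cast h

omit [DecidableEq σ₁] [DecidableEq σ₂] in
/-- **`‖f ⊠ g‖_{L²} = ‖f‖_{L²} ‖g‖_{L²}`.** [folklore] -/
theorem norm_toL2_tensorPi (f : SR σ₁) (g : SR σ₂) : ‖toL2 (tensorPi f g)‖ = ‖toL2 f‖ * ‖toL2 g‖ := by
  rw [norm_toL2_eq, norm_toL2_eq, norm_toL2_eq, integral_norm_sq_tensorPi,
    Real.mul_rpow (integral_nonneg fun _ => by positivity) (integral_nonneg fun _ => by positivity)]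

namespace IsBlockPair

variable {ι : G → PhaseMap (σ₁ ⊕ σ₂)} {ω : Representation ℂ G (SR (σ₁ ⊕ σ₂))}
  {ι₁ : G₁ → PhaseMap σ₁} {ω₁ : Representation ℂ G₁ (SR σ₁)} {s : G₁ →* G}

/-- **`|χ(u)| = 1` when `ω (s u)` and `ω₁ u` are restrictions of unitary operators** (as for archimedean Weil data,
(w2′)): compare `‖ω (s u) (h₀ ⊠ h₀)‖_{L²} = ‖h₀‖²` with `|χ(u)| ‖ω₁ u h₀‖ ‖h₀‖`. [folklore] -/
theorem norm_factorChar (h : IsBlockPair ι ω ι₁ ω₁ s) {u : G₁}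
    (hl : ∃ U : (L2R (σ₁ ⊕ σ₂)) ≃ₗᵢ[ℂ] L2R (σ₁ ⊕ σ₂), LiftsTo (ω (s u))
      ((U.toContinuousLinearEquiv : (L2R (σ₁ ⊕ σ₂)) ≃L[ℂ] L2R (σ₁ ⊕ σ₂)) : (L2R (σ₁ ⊕ σ₂)) →L[ℂ] L2R (σ₁ ⊕ σ₂)))
    (hl₁ : ∃ U₁ : (L2R σ₁) ≃ₗᵢ[ℂ] L2R σ₁, LiftsTo (ω₁ u)
      ((U₁.toContinuousLinearEquiv : (L2R σ₁) ≃L[ℂ] L2R σ₁) : (L2R σ₁) →L[ℂ] L2R σ₁)) :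
    ‖h.factorChar u‖ = 1 := by
  obtain ⟨U, hU⟩ := hl
  obtain ⟨U₁, hU₁⟩ := hl₁
  set f : SR σ₁ := hermitePi 0
  set g : SR σ₂ := hermitePi 0
  have h1 : ‖toL2 (ω (s u) (tensorPi f g))‖ = ‖toL2 f‖ * ‖toL2 g‖ := by
    rw [hU (tensorPi f g)]
    simp only [ContinuousLinearEquiv.coe_coe, LinearIsometryEquiv.coe_toContinuousLinearEquiv,
      LinearIsometryEquiv.norm_map, norm_toL2_tensorPi]
  have h2 : ‖toL2 (ω (s u) (tensorPi f g))‖ = ‖h.factorChar u‖ * (‖toL2 f‖ * ‖toL2 g‖) := by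
    rw [h.apply_tensorPi u f g, map_smul, norm_smul, norm_toL2_tensorPi, hU₁ f]
    simp only [ContinuousLinearEquiv.coe_coe, LinearIsometryEquiv.coe_toContinuousLinearEquiv,
      LinearIsometryEquiv.norm_map]
  have hf : ‖toL2 f‖ ≠ 0 := norm_ne_zero_iff.2 fun h0 => hermitePi_ne_zero (0 : σ₁ →₀ ℕ)
    (toL2_injective (h0.trans (map_zero _).symm))
  have hg : ‖toL2 g‖ ≠ 0 := norm_ne_zero_iff.2 fun h0 => hermitePi_ne_zero (0 : σ₂ →₀ ℕ)
    (toL2_injective (h0.trans (map_zero _).symm))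
  have h3 : ‖h.factorChar u‖ * (‖toL2 f‖ * ‖toL2 g‖) = 1 * (‖toL2 f‖ * ‖toL2 g‖) := by rw [← h2, h1, one_mul]
  exact mul_right_cancel₀ (mul_ne_zero hf hg) h3

/-! ### §3c Continuity of the factor character under orbit continuity -/

omit [DecidableEq σ₁] in
/-- point evaluation is continuous on `𝓢`. [folklore] -/
theorem continuous_eval (x : σ₁ → ℝ) : Continuous fun F : SR σ₁ => F x :=
  ((BoundedContinuousFunction.evalCLM ℂ x).comp (SchwartzMap.toBoundedContinuousFunctionCLM ℂ (σ₁ → ℝ) ℂ)).continuous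

/-- **`χ` is continuous when both families are orbit-continuous** ((w1) of `IsArchWeilDatum`) and `s` is continuous:
near `u₀`, `χ(u) = (ω (s u) (h₀ ⊠ h₀))(x₀) / ((ω₁ u h₀) ⊠ h₀)(x₀)` at a point `x₀` where the denominator does not
vanish at `u₀`. [folklore] -/
theorem continuous_factorChar [TopologicalSpace G] [TopologicalSpace G₁] (h : IsBlockPair ι ω ι₁ ω₁ s)
    (hs : Continuous s) (hω : ∀ F : SR (σ₁ ⊕ σ₂), Continuous fun g => ω g F)
    (hω₁ : ∀ f : SR σ₁, Continuous fun u => ω₁ u f) : Continuous h.factorChar := by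
  set f : SR σ₁ := hermitePi 0
  set g : SR σ₂ := hermitePi 0
  refine continuous_iff_continuousAt.2 fun u₀ => ?_
  have hT : tensorPi (ω₁ u₀ f) g ≠ 0 := tensorPi_ne_zero
    (fun h0 => hermitePi_ne_zero (0 : σ₁ →₀ ℕ) (h.injective₁ u₀ (h0.trans (map_zero _).symm)))
    (hermitePi_ne_zero 0)
  obtain ⟨x₀, hx₀⟩ : ∃ x₀, tensorPi (ω₁ u₀ f) g x₀ ≠ 0 := by
    by_contra h0; push Not at h0; exact hT (SchwartzMap.ext h0)
  -- numerator and denominator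
  have hA : Continuous fun u => ω (s u) (tensorPi f g) x₀ :=
    (continuous_eval x₀).comp ((hω (tensorPi f g)).comp hs)
  have hB : Continuous fun u => tensorPi (ω₁ u f) g x₀ := by
    simp only [tensorPi_apply]
    exact ((continuous_eval (x₀ ∘ Sum.inl)).comp (hω₁ f)).mul continuous_const
  have hAB : ∀ u, h.factorChar u * tensorPi (ω₁ u f) g x₀ = ω (s u) (tensorPi f g) x₀ := fun u => by
    rw [h.apply_tensorPi u f g, smul_apply, smul_eq_mul]
  have hne : ∀ᶠ u in nhds u₀, tensorPi (ω₁ u f) g x₀ ≠ 0 := hB.continuousAt.eventually_ne hx₀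
  refine ((hA.continuousAt.div hB.continuousAt hx₀).congr ?_)
  filter_upwards [hne] with u hu
  exact (eq_div_of_mul_eq hu (hAB u)).symm

end IsBlockPair

end Character

/-! ## §4 The twisted small family and the exact factorisation -/

section TwistFactor

variable {σ₁ σ₂ : Type*} [Fintype σ₁] [Fintype σ₂] [DecidableEq σ₁] [DecidableEq σ₂]
variable {G₁ G : Type*} [Group G₁] [Group G]
variable {ι : G → PhaseMap (σ₁ ⊕ σ₂)} {ω : Representation ℂ G (SR (σ₁ ⊕ σ₂))}
  {ι₁ : G₁ → PhaseMap σ₁} {ω₁ : Representation ℂ G₁ (SR σ₁)} {s : G₁ →* G}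

namespace IsBlockPair

/-- **EXACT FACTORISATION by the twisted small family**:
`ω (s u) (Φ₁ ⊠ Φ₂) = (charTwist χ ω₁ u Φ₁) ⊠ Φ₂` with `χ` the factor character. [folklore] -/
theorem apply_tensorPi_eq_twist (h : IsBlockPair ι ω ι₁ ω₁ s) (u : G₁) (Φ₁ : SR σ₁) (Φ₂ : SR σ₂) :
    ω (s u) (tensorPi Φ₁ Φ₂) = tensorPi (charTwist h.factorCharHom ω₁ u Φ₁) Φ₂ := by
  rw [charTwist_apply, factorCharHom_apply, tensorPi_smul_left, h.apply_tensorPi]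

/-- the twisted small family is again Heisenberg-covariant over `ι₁`. [folklore] -/
theorem covariant_twist (h : IsBlockPair ι ω ι₁ ω₁ s) :
    IsPhaseCovariantS ι₁ (fun u => charTwist h.factorCharHom ω₁ u) := fun u p q f => by
  simp only [charTwist_apply, map_smul]
  rw [h.covariant₁ u p q f]

/-- the twisted small operators are continuous. [folklore] -/
theorem continuous_op_twist (h : IsBlockPair ι ω ι₁ ω₁ s) (u : G₁) :
    Continuous (charTwist h.factorCharHom ω₁ u) := by
  show Continuous fun x => charTwist h.factorCharHom ω₁ u x
  simp only [charTwist_apply]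
  exact (h.continuous_op₁ u).const_smul (h.factorCharHom u)

/-- **the twisted pair is a block pair with TRIVIAL character.** [folklore] -/
theorem twist (h : IsBlockPair ι ω ι₁ ω₁ s) : IsBlockPair ι ω ι₁ (charTwist h.factorCharHom ω₁) s where
  covariant := h.covariant
  continuous_op := h.continuous_op
  covariant₁ := h.covariant_twist
  continuous_op₁ := h.continuous_op_twist
  block := h.block

/-- the factor character of the twisted pair is `1`. [folklore] -/
theorem factorChar_twist (h : IsBlockPair ι ω ι₁ ω₁ s) (u : G₁) : h.twist.factorChar u = 1 :=
  (h.twist.eq_factorChar (hermitePi_ne_zero (0 : σ₁ →₀ ℕ)) (hermitePi_ne_zero (0 : σ₂ →₀ ℕ))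
    (by rw [one_smul, h.apply_tensorPi_eq_twist])).symm

end IsBlockPair

end TwistFactor

/-! ## §5 Archimedean Weil data: the twisted small datum is a Weil datum factorising the big one exactly -/

section WeilData

variable {σ₁ σ₂ : Type*} [Fintype σ₁] [Fintype σ₂] [DecidableEq σ₁] [DecidableEq σ₂]
variable {G₁ G : Type*} [Group G₁] [Group G] [TopologicalSpace G₁] [TopologicalSpace G]

namespace IsBlockPair

variable {ι : G → PhaseMap (σ₁ ⊕ σ₂)} {ω : Representation ℂ G (SR (σ₁ ⊕ σ₂))}
  {ι₁ : G₁ → PhaseMap σ₁} {ω₁ : Representation ℂ G₁ (SR σ₁)} {s : G₁ →* G}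

omit [TopologicalSpace G₁] [TopologicalSpace G] in
/-- **The factor character as a homomorphism into the circle**, when all `ω (s u)` and `ω₁ u` have unitary lifts.
[folklore] -/
def factorCharCircle (h : IsBlockPair ι ω ι₁ ω₁ s)
    (hl : ∀ u, ∃ U : (L2R (σ₁ ⊕ σ₂)) ≃ₗᵢ[ℂ] L2R (σ₁ ⊕ σ₂), LiftsTo (ω (s u))
      ((U.toContinuousLinearEquiv : (L2R (σ₁ ⊕ σ₂)) ≃L[ℂ] L2R (σ₁ ⊕ σ₂)) : (L2R (σ₁ ⊕ σ₂)) →L[ℂ] L2R (σ₁ ⊕ σ₂)))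
    (hl₁ : ∀ u, ∃ U₁ : (L2R σ₁) ≃ₗᵢ[ℂ] L2R σ₁, LiftsTo (ω₁ u)
      ((U₁.toContinuousLinearEquiv : (L2R σ₁) ≃L[ℂ] L2R σ₁) : (L2R σ₁) →L[ℂ] L2R σ₁)) : G₁ →* Circle where
  toFun u := ⟨h.factorChar u, mem_sphere_zero_iff_norm.2 (h.norm_factorChar (hl u) (hl₁ u))⟩
  map_one' := Subtype.ext (by simpa using h.factorChar_one)
  map_mul' u v := Subtype.ext (by simpa using h.factorChar_mul u v)

omit [TopologicalSpace G₁] [TopologicalSpace G] in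
/-- Unfolding. [folklore] -/
@[simp] theorem coe_factorCharCircle (h : IsBlockPair ι ω ι₁ ω₁ s)
    (hl : ∀ u, ∃ U : (L2R (σ₁ ⊕ σ₂)) ≃ₗᵢ[ℂ] L2R (σ₁ ⊕ σ₂), LiftsTo (ω (s u))
      ((U.toContinuousLinearEquiv : (L2R (σ₁ ⊕ σ₂)) ≃L[ℂ] L2R (σ₁ ⊕ σ₂)) : (L2R (σ₁ ⊕ σ₂)) →L[ℂ] L2R (σ₁ ⊕ σ₂)))
    (hl₁ : ∀ u, ∃ U₁ : (L2R σ₁) ≃ₗᵢ[ℂ] L2R σ₁, LiftsTo (ω₁ u)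
      ((U₁.toContinuousLinearEquiv : (L2R σ₁) ≃L[ℂ] L2R σ₁) : (L2R σ₁) →L[ℂ] L2R σ₁)) (u : G₁) :
    ((h.factorCharCircle hl hl₁ u : Circle) : ℂ) = h.factorChar u := rfl

omit [TopologicalSpace G₁] [TopologicalSpace G] in
/-- `Circle.coeHom ∘ factorCharCircle = factorCharHom`. [folklore] -/
theorem coeHom_comp_factorCharCircle (h : IsBlockPair ι ω ι₁ ω₁ s)
    (hl : ∀ u, ∃ U : (L2R (σ₁ ⊕ σ₂)) ≃ₗᵢ[ℂ] L2R (σ₁ ⊕ σ₂), LiftsTo (ω (s u))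
      ((U.toContinuousLinearEquiv : (L2R (σ₁ ⊕ σ₂)) ≃L[ℂ] L2R (σ₁ ⊕ σ₂)) : (L2R (σ₁ ⊕ σ₂)) →L[ℂ] L2R (σ₁ ⊕ σ₂)))
    (hl₁ : ∀ u, ∃ U₁ : (L2R σ₁) ≃ₗᵢ[ℂ] L2R σ₁, LiftsTo (ω₁ u)
      ((U₁.toContinuousLinearEquiv : (L2R σ₁) ≃L[ℂ] L2R σ₁) : (L2R σ₁) →L[ℂ] L2R σ₁)) :
    Circle.coeHom.comp (h.factorCharCircle hl hl₁) = h.factorCharHom :=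
  MonoidHom.ext fun _ => rfl

end IsBlockPair

namespace IsArchWeilDatum

omit [DecidableEq σ₁] [DecidableEq σ₂] in
/-- **Two archimedean Weil data, the big one block-diagonal along `s`, form a block pair** (given operator
continuity, which (w1)–(w2′) do not assert). [folklore] -/
theorem isBlockPair {ι𝕎 : G →* SpR (σ₁ ⊕ σ₂)} {ω : Representation ℂ G (SR (σ₁ ⊕ σ₂))}
    (hW : IsArchWeilDatum ι𝕎 ω) (hc : ∀ g, Continuous (ω g))
    {ι𝕎₁ : G₁ →* SpR σ₁} {ω₁ : Representation ℂ G₁ (SR σ₁)} (hW₁ : IsArchWeilDatum ι𝕎₁ ω₁)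
    (hc₁ : ∀ u, Continuous (ω₁ u)) (s : G₁ →* G)
    (hs : ∀ u, (⇑((ι𝕎 (s u)).1 : (PV (σ₁ ⊕ σ₂)) ≃ₗ[ℝ] PV (σ₁ ⊕ σ₂)) : PhaseMap (σ₁ ⊕ σ₂)) =
      blockPhase (⇑((ι𝕎₁ u).1 : (PV σ₁) ≃ₗ[ℝ] PV σ₁)) id) :
    IsBlockPair (fun g => (⇑((ι𝕎 g).1 : (PV (σ₁ ⊕ σ₂)) ≃ₗ[ℝ] PV (σ₁ ⊕ σ₂)) : PhaseMap (σ₁ ⊕ σ₂))) ω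
      (fun u => (⇑((ι𝕎₁ u).1 : (PV σ₁) ≃ₗ[ℝ] PV σ₁) : PhaseMap σ₁)) ω₁ s where
  covariant := hW.covariant
  continuous_op := hc
  covariant₁ := hW₁.covariant
  continuous_op₁ := hc₁
  block := hs

/-- **THE ARCHIMEDEAN FACTORISATION AT PRODUCT VECTORS (model item (T-j)).**  Let `ω` be an archimedean Weil datum
of `G` on `𝓢(ℝ^{σ₁ ⊕ σ₂})` and `ω₁` one of `G₁` on `𝓢(ℝ^{σ₁})`, both with continuous operators, and `s : G₁ →* G` a
continuous homomorphism along which the symplectic image of `G` is block-diagonal with identity second block.  Then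
there is an archimedean Weil datum `ω₁'` of `G₁` over the SAME `ι𝕎₁` (namely `ω₁` twisted, `charTwist`, by the
continuous unitary factor character), with continuous operators, such that for all `u, Φ₁, Φ₂`
`ω (s u) (Φ₁ ⊠ Φ₂) = (ω₁' u Φ₁) ⊠ Φ₂` — EXACTLY, with no scalar.  [cite: Folland1989, Prop. (1.43), §4.2 (4.23)] -/
theorem exists_twist_factorisation {ι𝕎 : G →* SpR (σ₁ ⊕ σ₂)} {ω : Representation ℂ G (SR (σ₁ ⊕ σ₂))}
    (hW : IsArchWeilDatum ι𝕎 ω) (hc : ∀ g, Continuous (ω g))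
    {ι𝕎₁ : G₁ →* SpR σ₁} {ω₁ : Representation ℂ G₁ (SR σ₁)} (hW₁ : IsArchWeilDatum ι𝕎₁ ω₁)
    (hc₁ : ∀ u, Continuous (ω₁ u)) (s : G₁ →* G) (hs_cont : Continuous s)
    (hs : ∀ u, (⇑((ι𝕎 (s u)).1 : (PV (σ₁ ⊕ σ₂)) ≃ₗ[ℝ] PV (σ₁ ⊕ σ₂)) : PhaseMap (σ₁ ⊕ σ₂)) =
      blockPhase (⇑((ι𝕎₁ u).1 : (PV σ₁) ≃ₗ[ℝ] PV σ₁)) id) :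
    ∃ ω₁' : Representation ℂ G₁ (SR σ₁), IsArchWeilDatum ι𝕎₁ ω₁' ∧ (∀ u, Continuous (ω₁' u)) ∧
      ∀ (u : G₁) (Φ₁ : SR σ₁) (Φ₂ : SR σ₂), ω (s u) (tensorPi Φ₁ Φ₂) = tensorPi (ω₁' u Φ₁) Φ₂ := by
  have h := hW.isBlockPair hc hW₁ hc₁ s hs
  have hl : ∀ u, ∃ U : (L2R (σ₁ ⊕ σ₂)) ≃ₗᵢ[ℂ] L2R (σ₁ ⊕ σ₂), LiftsTo (ω (s u))
      ((U.toContinuousLinearEquiv : (L2R (σ₁ ⊕ σ₂)) ≃L[ℂ] L2R (σ₁ ⊕ σ₂)) :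
        (L2R (σ₁ ⊕ σ₂)) →L[ℂ] L2R (σ₁ ⊕ σ₂)) := fun u => hW.exists_lift (s u)
  have hχc : Continuous (h.factorCharCircle hl hW₁.exists_lift) :=
    Continuous.subtype_mk (h.continuous_factorChar hs_cont hW.continuous_apply hW₁.continuous_apply) _
  refine ⟨Weil1964.charTwist (Circle.coeHom.comp (h.factorCharCircle hl hW₁.exists_lift)) ω₁,
    hW₁.twist _ hχc, fun u => ?_, fun u Φ₁ Φ₂ => ?_⟩
  · rw [h.coeHom_comp_factorCharCircle]; exact h.continuous_op_twist u
  · rw [h.coeHom_comp_factorCharCircle]; exact h.apply_tensorPi_eq_twist u Φ₁ Φ₂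

end IsArchWeilDatum

end WeilData


end Literature.NumberTheory.Weil1964

end
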